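import Summits.CriticalPhenomena.PercolationContinuityZ3.Theorems.Transplant.FKConnectivityAllQWheelFormula
import HarnessLib

/-!
# Connectivity correlation inequalities for `φ_{w,q}`, every `q > 0` — THEOREM W: any two SPOKES of an apex-over-cycle weighted graph (every wheel
# `W_n`, any spoke subset, any weights) are negatively correlated under `φ_{w,q}` for every `0 < q ≤ 1`

Support file (`--supports stmt-CriticalPhenomena-4575`), FK sub-lane `prim-bschramm-fk-3` (gen 8) of the post-continuity programme; builds on
p205010 (kernel theorem, internal audit signed; external expert review pending).  No definitions, no named facts, no sorries; standard axioms.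
Paper proof and blueprint: bschramm/prim-bschramm-fk-3/WHEELS-HUB-NC.md §0–§5 (every displayed identity machine-checked before formalisation).

**`FK.Wheel.wheel_negCorr_spokes`** — `V` finite with `Fintype.card V = n + 1`, `n ≥ 3`; hub `x`; pairwise distinct rim vertices `v 0, …, v (n−1)`
(`≠ x`); `w` any weight vector supported on the wheel pairs (spokes `s(x, v j)` and rim pairs `s(v j, v (j+1 mod n))`, parameters arbitrary in
`[0,1]`); `0 < q ≤ 1`.  Then for the spokes `e = s(x, v y)`, `f = s(x, v (y+d))` (`1 ≤ d ≤ n−1`) of two distinct rim vertices,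
`φ_{w,q}(J_e ∩ J_f) ≤ φ_{w,q}(J_e)·φ_{w,q}(J_f)`.
For wheels with `≥ 4` rim vertices the non-consecutive spoke pairs are DISJOINT pairs of a 3-connected non-series-parallel graph — outside Wagner's class of
Potts–Rayleigh graphs (series–parallel and `K₄` two-sums, Wagner 2008 §5.3) and, as far as searched, not in print for any `q < 1`.
PROOF (kernel, this file = assembly): LEMMA T (`rcPartitionFunctionW_eq_transferT`, `…AllQWheelFormula.lean`) expresses the four partition functions
`Z_w`, `Z_{w[e↦1]}`, `Z_{w[f↦1]}`, `Z_{w[e,f↦1]}` through the cyclic transfer word; pinning a spoke replaces its matrix `S(p)` by `P` (`letter_update_spoke`);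
splitting the word at the two spokes (`trace_seg_rotate`, `seg_add`) gives `Z = q·F(S(a),S(b))` for the bilinear functional
`F(X,Y) = Tr(B·Y·A·X) − (2−q)ρ_Aρ_B·X₂₂Y₂₂` of the two rim stretches `A, B` (which carry the invariants `RimInv`, `…AllQWheelTransfer.lean`, by
`RimInv.one/edge_mul/spoke_mul`); `S(p) = (1−p)·1 + p·P` turns `Z_{11}Z − Z_{1·}Z_{·1}` into `−q²(1−a)(1−b)·[F(P,I)F(I,P) − F(P,P)F(I,I)] ≤ 0` by
`wheelHub_trace_form`; finally `S_w(J_e) = (w e)·Z_{w[e↦1]}`, `S_w(J_e ∩ J_f) = (w e)(w f)·Z_{w[e,f↦1]}` convert to probabilities.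
[cite: Grimmett2006, §1.4 eq. (1.20) (p. 15); §3.9 eq. (3.94), Conj. (3.96) (pp. 63–66)] [cite: Wagner2006, Thm. 5.8, §5.3 (pp. 14–15)]
-/

noncomputable section

namespace Summit.CriticalPhenomena.PercolationContinuityZ3.Theorems

namespace FK

namespace Wheel

open Matrix WheelTM Literature.Probability.LatticeModels Literature.Probability.Percolation
open Literature.Probability.Percolation.DecisionTree (ind ind_of_mem ind_of_not_mem ind_nonneg)
open scoped Classical

variable {V : Type*} [Fintype V]

/-! ### Small tools -/

omit [Fintype V] in
/-- Residues of `i + t` and `i` differ when `0 < t < n`. [folklore] -/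
theorem mod_add_ne_mod {i t n : ℕ} (ht0 : 0 < t) (htn : t < n) : (i + t) % n ≠ i % n := by
  intro h
  have h1 : (i + t) % n = (i + 0) % n := by rw [Nat.add_zero]; exact h
  have h2 := Nat.ModEq.add_left_cancel' i h1
  rw [Nat.ModEq, Nat.mod_eq_of_lt htn, Nat.zero_mod] at h2
  omega

omit [Fintype V] in
/-- A product over `range (d + 1 + m)` split as: index `0`, the next `d − 1`, index `d`, the last `m` (`1 ≤ d`). [folklore] -/
theorem prod_range_split (F : ℕ → ℝ) {d : ℕ} (m : ℕ) (hd1 : 1 ≤ d) :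
    ∏ i ∈ Finset.range (d + 1 + m), F i =
      F 0 * (∏ i ∈ Finset.range (d - 1), F (1 + i)) * F d * ∏ i ∈ Finset.range m, F (d + 1 + i) := by
  rw [Finset.prod_range_add, Finset.prod_range_succ]
  have h : ∏ i ∈ Finset.range d, F i = F 0 * ∏ i ∈ Finset.range (d - 1), F (1 + i) := by
    obtain ⟨k, rfl⟩ : ∃ k, d = 1 + k := ⟨d - 1, by omega⟩
    rw [Finset.prod_range_add, Finset.prod_range_one, Nat.add_sub_cancel_left]
  rw [h]

/-- A stretch product `seg a ℓ · M` carries `RimInv` with weight `(∏_{i<ℓ} r_{a+i}(1−p_{a+i}))·ρ` if `M` carries it with `ρ`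
(parameters in `[0,1]`, `0 ≤ q ≤ 1`). [folklore] -/
theorem rimInv_seg_mul {q : ℝ} (hq0 : 0 ≤ q) (hq1 : q ≤ 1) {p r : ℕ → ℝ} (hp : ∀ j, 0 ≤ p j ∧ p j ≤ 1) (hr : ∀ j, 0 ≤ r j ∧ r j ≤ 1)
    (n a : ℕ) {ρ : ℝ} {M : Matrix (Fin 2) (Fin 2) ℝ} (hM : RimInv q ρ M) (ℓ : ℕ) :
    RimInv q ((∏ i ∈ Finset.range ℓ, (r ((a + i) % n) * (1 - p ((a + i) % n)))) * ρ) (seg q p r n a ℓ * M) := by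
  induction ℓ with
  | zero => simpa [seg_zero] using hM
  | succ ℓ ih =>
    rw [Finset.prod_range_succ, seg_succ, Matrix.mul_assoc]
    unfold letter
    rw [Matrix.mul_assoc]
    have h1 := ih.spoke_mul hq0 hq1 (hp ((a + ℓ) % n)).1 (hp ((a + ℓ) % n)).2
    have h2 := h1.edge_mul hq0 hq1 (hr ((a + ℓ) % n)).1 (hr ((a + ℓ) % n)).2
    convert h2 using 1
    ring

/-! ### Masses of spoke events through pinned partition functions -/

/-- Under `w e = 1` the pair `e` is almost surely open: `S(J_e ∩ F) = S(F)`. [cite: Grimmett2006, §1.4 eq. (1.20) (p. 15)] -/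
theorem sum_openPair_inter_of_one (w : Sym2 V → unitInterval) (q : ℝ) {e : Sym2 V} (he : ((w e : unitInterval) : ℝ) = 1) (F : Set (BondConfig V)) :
    ∑ ω : BondConfig V, rcWeightW w q ∅ ω * ind ({ω : BondConfig V | e ∈ ω} ∩ F) ω = ∑ ω : BondConfig V, rcWeightW w q ∅ ω * ind F ω := by
  refine Finset.sum_congr rfl fun ω _ => ?_
  by_cases hω : e ∈ ω
  · congr 1
    by_cases hF : ω ∈ F
    · rw [ind_of_mem hF, ind_of_mem (show ω ∈ {ω : BondConfig V | e ∈ ω} ∩ F from ⟨hω, hF⟩)]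
    · rw [ind_of_not_mem hF, ind_of_not_mem (fun h => hF h.2)]
  · rw [rcWeightW_eq_zero_of_one_not_mem w q ∅ he hω, zero_mul, zero_mul]

/-- `S_w(J_e ∩ F) = (w e)·S_{w[e↦1]}(F)`. [cite: Grimmett2006, §1.4 eq. (1.20) (p. 15)] -/
theorem sum_openPair_inter_eq (w : Sym2 V → unitInterval) (q : ℝ) (e : Sym2 V) (F : Set (BondConfig V)) :
    ∑ ω : BondConfig V, rcWeightW w q ∅ ω * ind ({ω : BondConfig V | e ∈ ω} ∩ F) ω =
      ((w e : unitInterval) : ℝ) * ∑ ω : BondConfig V, rcWeightW (Function.update w e 1) q ∅ ω * ind F ω := by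
  rw [sum_rcWeightW_ind_affine w q e, sum_rcWeightW_ind_inter_openPair_of_zero _ q (by simp) F, mul_zero, zero_add,
    sum_openPair_inter_of_one _ q (by simp) F]

/-- `S_w(J_e) = (w e)·Z_{w[e↦1]}`. [cite: Grimmett2006, §1.4 eq. (1.20) (p. 15)] -/
theorem sum_openPair_eq_mul_Z (w : Sym2 V → unitInterval) (q : ℝ) (e : Sym2 V) :
    ∑ ω : BondConfig V, rcWeightW w q ∅ ω * ind {ω : BondConfig V | e ∈ ω} ω =
      ((w e : unitInterval) : ℝ) * rcPartitionFunctionW (Function.update w e 1) q ∅ := by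
  have h := sum_openPair_inter_eq w q e Set.univ
  rw [Set.inter_univ] at h
  rw [h]
  congr 1
  unfold rcPartitionFunctionW
  exact Finset.sum_congr rfl fun ω _ => by rw [ind_of_mem (Set.mem_univ ω), mul_one]

/-- `S_w(J_e ∩ J_f) = (w e)(w f)·Z_{w[e↦1][f↦1]}` for `f ≠ e`. [cite: Grimmett2006, §1.4 eq. (1.20) (p. 15)] -/
theorem sum_openPair_inter_openPair_eq (w : Sym2 V → unitInterval) (q : ℝ) {e f : Sym2 V} (hfe : f ≠ e) :
    ∑ ω : BondConfig V, rcWeightW w q ∅ ω * ind ({ω : BondConfig V | e ∈ ω} ∩ {ω | f ∈ ω}) ω =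
      ((w e : unitInterval) : ℝ) * ((w f : unitInterval) : ℝ) *
        rcPartitionFunctionW (Function.update (Function.update w e 1) f 1) q ∅ := by
  rw [sum_openPair_inter_eq w q e, sum_openPair_eq_mul_Z, Function.update_of_ne hfe, mul_assoc]

/-! ### THEOREM W -/

section Main

variable {x : V} {v : ℕ → V} {n : ℕ}
variable (hn : 3 ≤ n) (hinj : ∀ j k, j < n → k < n → v j = v k → j = k) (hx : ∀ j, j < n → v j ≠ x) (hcard : Fintype.card V = n + 1)
include hn hinj hx hcard

omit [Fintype V] hn hinj hx hcard in
/-- Updating a spoke keeps the support inside the wheel pairs. [folklore] -/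
theorem supp_update_spoke (w : Sym2 V → unitInterval) (hsupp : ∀ e, e ∉ wheelPairs x v n → w e = 0) {j : ℕ} (hj : j < n)
    (c : unitInterval) : ∀ e, e ∉ wheelPairs x v n → Function.update w (spokePair x v n j) c e = 0 := by
  intro e he
  have hne : e ≠ spokePair x v n j := fun h => he (h ▸ (mem_wheelPairs_iff _).2 (Or.inl ⟨j, hj, rfl⟩))
  rw [Function.update_of_ne hne]
  exact hsupp e he

omit [Fintype V] hcard in
/-- **The partition function through the two-slot functional**: for the weight vector `w` with the spokes of `v y` and `v (y+d)` re-pinned to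
`a', b'`, `Z = q·(Tr(B·S(b')·A·S(a')) − (2−q)·(ρ_Aρ_B)·((1−a')(1−b')))`, where `A = seg (y+1) (d−1) · E(r_y)`,
`B = seg (y+d+1) (n−d−1) · E(r_{y+d})` are the two rim stretches and `ρ_A, ρ_B` their weight products. [folklore] -/
theorem transferT_two_slot (q : ℝ) (w : Sym2 V → unitInterval) {y d : ℕ} (hy : y < n) (hd1 : 1 ≤ d) (hdn : d + 1 ≤ n)
    (a' b' : unitInterval) :
    transferT q (Function.update (Function.update w (spokePair x v n y) a') (spokePair x v n (y + d)) b') x v n =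
      q * (((seg q (pOf w x v n) (rOf w v n) n (y + d + 1) (n - d - 1) * edgeM q (rOf w v n ((y + d) % n))) * spokeM (b' : ℝ) *
              (seg q (pOf w x v n) (rOf w v n) n (y + 1) (d - 1) * edgeM q (rOf w v n y)) * spokeM (a' : ℝ)).trace -
        (2 - q) * (((∏ i ∈ Finset.range (d - 1), (rOf w v n ((y + 1 + i) % n) * (1 - pOf w x v n ((y + 1 + i) % n)))) * rOf w v n y) *
            ((∏ i ∈ Finset.range (n - d - 1), (rOf w v n ((y + d + 1 + i) % n) * (1 - pOf w x v n ((y + d + 1 + i) % n)))) *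
              rOf w v n ((y + d) % n))) *
          ((1 - (a' : ℝ)) * (1 - (b' : ℝ)))) := by
  have hn1 : 1 ≤ n := by omega
  have hzlt : (y + d) % n < n := Nat.mod_lt _ (by omega)
  have hymod : y % n = y := Nat.mod_eq_of_lt hy
  have hyz : (y + d) % n ≠ y := fun h => mod_add_ne_mod (i := y) (t := d) (n := n) (by omega) (by omega) (h.trans hymod.symm)
  have hspz : spokePair x v n (y + d) = spokePair x v n ((y + d) % n) := (spokePair_mod x v n (y + d)).symm
  -- letters of the re-pinned weight vector
  have hL₁ := letter_update_spoke hn hinj hx q w hy a'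
  have hL : ∀ j, letter q (pOf (Function.update (Function.update w (spokePair x v n y) a') (spokePair x v n (y + d)) b') x v n)
      (rOf (Function.update (Function.update w (spokePair x v n y) a') (spokePair x v n (y + d)) b') v n) n j =
      if j % n = (y + d) % n then edgeM q (rOf (Function.update w (spokePair x v n y) a') v n ((y + d) % n)) * spokeM (b' : ℝ)
      else letter q (pOf (Function.update w (spokePair x v n y) a') x v n) (rOf (Function.update w (spokePair x v n y) a') v n) n j := by
    intro j
    rw [hspz]
    exact letter_update_spoke hn hinj hx q _ hzlt b' j
  have hr₁ : ∀ j, rOf (Function.update w (spokePair x v n y) a') v n j = rOf w v n j := fun j => rOf_update_spoke hn hx w y a' j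
  -- unpinned letters
  have hLw : ∀ j, j % n ≠ y → j % n ≠ (y + d) % n →
      letter q (pOf (Function.update (Function.update w (spokePair x v n y) a') (spokePair x v n (y + d)) b') x v n)
        (rOf (Function.update (Function.update w (spokePair x v n y) a') (spokePair x v n (y + d)) b') v n) n j =
      letter q (pOf w x v n) (rOf w v n) n j := by
    intro j h1 h2
    rw [hL j, if_neg h2, hL₁ j, if_neg h1]
  have hLy : letter q (pOf (Function.update (Function.update w (spokePair x v n y) a') (spokePair x v n (y + d)) b') x v n)
      (rOf (Function.update (Function.update w (spokePair x v n y) a') (spokePair x v n (y + d)) b') v n) n y =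
      edgeM q (rOf w v n y) * spokeM (a' : ℝ) := by
    rw [hL y, if_neg (by rw [hymod]; exact fun h => hyz h.symm), hL₁ y, if_pos hymod]
  have hLz : letter q (pOf (Function.update (Function.update w (spokePair x v n y) a') (spokePair x v n (y + d)) b') x v n)
      (rOf (Function.update (Function.update w (spokePair x v n y) a') (spokePair x v n (y + d)) b') v n) n (y + d) =
      edgeM q (rOf w v n ((y + d) % n)) * spokeM (b' : ℝ) := by
    rw [hL (y + d), if_pos rfl, hr₁]
  -- abbreviations (propositional, safe for rewriting)
  obtain ⟨u, hu⟩ : ∃ u, u = Function.update (Function.update w (spokePair x v n y) a') (spokePair x v n (y + d)) b' := ⟨_, rfl⟩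
  rw [← hu] at hL hLw hLy hLz ⊢
  -- the word read from `y`
  have hword : seg q (pOf u x v n) (rOf u v n) n y n =
      (seg q (pOf w x v n) (rOf w v n) n (y + d + 1) (n - d - 1) * edgeM q (rOf w v n ((y + d) % n))) * spokeM (b' : ℝ) *
        (seg q (pOf w x v n) (rOf w v n) n (y + 1) (d - 1) * edgeM q (rOf w v n y)) * spokeM (a' : ℝ) := by
    have e1 : seg q (pOf u x v n) (rOf u v n) n y n = seg q (pOf u x v n) (rOf u v n) n (y + 1) (n - 1) * letter q (pOf u x v n) (rOf u v n) n y := by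
      have := seg_add q (pOf u x v n) (rOf u v n) n y 1 (n - 1)
      rw [show 1 + (n - 1) = n by omega] at this
      rw [this]
      simp only [seg_succ, seg_zero, Matrix.mul_one, Nat.add_zero]
    have e2 : seg q (pOf u x v n) (rOf u v n) n (y + 1) (n - 1) =
        seg q (pOf u x v n) (rOf u v n) n (y + d + 1) (n - d - 1) * letter q (pOf u x v n) (rOf u v n) n (y + d) *
          seg q (pOf u x v n) (rOf u v n) n (y + 1) (d - 1) := by
      have h3 := seg_add q (pOf u x v n) (rOf u v n) n (y + 1) (d - 1) (n - d)
      rw [show d - 1 + (n - d) = n - 1 by omega, show y + 1 + (d - 1) = y + d by omega] at h3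
      have h4 := seg_add q (pOf u x v n) (rOf u v n) n (y + d) 1 (n - d - 1)
      rw [show 1 + (n - d - 1) = n - d by omega] at h4
      rw [h3, h4]
      simp only [seg_succ, seg_zero, Matrix.mul_one, Nat.add_zero]
    have eA : seg q (pOf u x v n) (rOf u v n) n (y + 1) (d - 1) = seg q (pOf w x v n) (rOf w v n) n (y + 1) (d - 1) := by
      refine seg_congr n q _ _ fun j hj hj' => hLw j ?_ ?_
      · obtain ⟨t, rfl⟩ : ∃ t, j = y + t := ⟨j - y, by omega⟩
        exact fun h => mod_add_ne_mod (i := y) (t := t) (n := n) (by omega) (by omega) (h.trans hymod.symm)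
      · obtain ⟨t, ht⟩ : ∃ t, y + d = j + t := ⟨y + d - j, by omega⟩
        rw [ht]; exact fun h => mod_add_ne_mod (i := j) (t := t) (n := n) (by omega) (by omega) h.symm
    have eB : seg q (pOf u x v n) (rOf u v n) n (y + d + 1) (n - d - 1) = seg q (pOf w x v n) (rOf w v n) n (y + d + 1) (n - d - 1) := by
      refine seg_congr n q _ _ fun j hj hj' => hLw j ?_ ?_
      · obtain ⟨t, rfl⟩ : ∃ t, j = y + t := ⟨j - y, by omega⟩
        exact fun h => mod_add_ne_mod (i := y) (t := t) (n := n) (by omega) (by omega) (h.trans hymod.symm)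
      · obtain ⟨t, rfl⟩ : ∃ t, j = y + d + t := ⟨j - (y + d), by omega⟩
        exact mod_add_ne_mod (by omega) (by omega)
    rw [e1, e2, eA, eB, hLy, hLz]
    simp only [Matrix.mul_assoc]
  -- the correction product: the full-cycle product of `r_j (1 − p_j)` for `u`, read from `y`
  have hru : ∀ j, rOf u v n j = rOf w v n j := fun j => by rw [hu, rOf_update_spoke hn hx _ (y + d) b' j, hr₁]
  have hpu : ∀ j, pOf u x v n j = if j % n = (y + d) % n then (b' : ℝ) else if j % n = y then (a' : ℝ) else pOf w x v n j := by
    intro j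
    rw [hu, hspz, pOf_update_spoke hn hinj _ hzlt b' j]
    by_cases h : j % n = (y + d) % n
    · rw [if_pos h, if_pos h]
    · rw [if_neg h, if_neg h, pOf_update_spoke hn hinj w hy a' j]
  have hprod : (∏ j ∈ Finset.range n, rOf u v n j) * ∏ j ∈ Finset.range n, (1 - pOf u x v n j) =
      (((∏ i ∈ Finset.range (d - 1), (rOf w v n ((y + 1 + i) % n) * (1 - pOf w x v n ((y + 1 + i) % n)))) * rOf w v n y) *
        ((∏ i ∈ Finset.range (n - d - 1), (rOf w v n ((y + d + 1 + i) % n) * (1 - pOf w x v n ((y + d + 1 + i) % n)))) *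
          rOf w v n ((y + d) % n))) * ((1 - (a' : ℝ)) * (1 - (b' : ℝ))) := by
    -- reindex the full product to start at `y`
    have hfull : (∏ j ∈ Finset.range n, rOf u v n j) * ∏ j ∈ Finset.range n, (1 - pOf u x v n j) =
        ∏ i ∈ Finset.range n, (fun m => rOf u v n m * (1 - pOf u x v n m)) ((y + i) % n) := by
      rw [← Finset.prod_mul_distrib]
      symm
      refine Finset.prod_nbij (fun i => (y + i) % n) (fun i _ => Finset.mem_range.2 (Nat.mod_lt _ (by omega))) ?_ ?_ (fun i _ => rfl)
      · intro i hi j hj h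
        have hi' := Finset.mem_range.1 (Finset.mem_coe.1 hi)
        have hj' := Finset.mem_range.1 (Finset.mem_coe.1 hj)
        have h2 := Nat.ModEq.add_left_cancel' y (show (y + i) % n = (y + j) % n from h)
        rw [Nat.ModEq, Nat.mod_eq_of_lt hi', Nat.mod_eq_of_lt hj'] at h2
        exact h2
      · intro m hm
        have hm' := Finset.mem_range.1 (Finset.mem_coe.1 hm)
        refine ⟨(m + n - y) % n, Finset.mem_coe.2 (Finset.mem_range.2 (Nat.mod_lt _ (by omega))), ?_⟩
        show (y + (m + n - y) % n) % n = m
        rw [Nat.add_mod, Nat.mod_mod, ← Nat.add_mod, show y + (m + n - y) = m + n by omega, Nat.add_mod_right,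
          Nat.mod_eq_of_lt hm']
    rw [hfull, show Finset.range n = Finset.range (d + 1 + (n - d - 1)) by congr 1; omega,
      prod_range_split (fun i => (fun m => rOf u v n m * (1 - pOf u x v n m)) ((y + i) % n)) (n - d - 1) hd1]
    -- evaluate the four pieces
    have fy : rOf u v n ((y + 0) % n) * (1 - pOf u x v n ((y + 0) % n)) = rOf w v n y * (1 - (a' : ℝ)) := by
      rw [Nat.add_zero, hymod, hru, hpu, hymod, if_neg (fun h => hyz h.symm), if_pos rfl]
    have fz : rOf u v n ((y + d) % n) * (1 - pOf u x v n ((y + d) % n)) = rOf w v n ((y + d) % n) * (1 - (b' : ℝ)) := by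
      rw [hru, hpu, Nat.mod_mod, if_pos rfl]
    have fA : ∀ i ∈ Finset.range (d - 1), rOf u v n ((y + (1 + i)) % n) * (1 - pOf u x v n ((y + (1 + i)) % n)) =
        rOf w v n ((y + 1 + i) % n) * (1 - pOf w x v n ((y + 1 + i) % n)) := by
      intro i hi
      have hi' := Finset.mem_range.1 hi
      rw [show y + (1 + i) = y + 1 + i by omega, hru, hpu, Nat.mod_mod, if_neg, if_neg]
      · rw [show y + 1 + i = y + (1 + i) by omega]
        exact fun h => mod_add_ne_mod (i := y) (t := 1 + i) (n := n) (by omega) (by omega) (h.trans hymod.symm)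
      · rw [show y + d = (y + 1 + i) + (d - 1 - i) by omega]
        exact fun h => mod_add_ne_mod (i := y + 1 + i) (t := d - 1 - i) (n := n) (by omega) (by omega) h.symm
    have fB : ∀ i ∈ Finset.range (n - d - 1), rOf u v n ((y + (d + 1 + i)) % n) * (1 - pOf u x v n ((y + (d + 1 + i)) % n)) =
        rOf w v n ((y + d + 1 + i) % n) * (1 - pOf w x v n ((y + d + 1 + i) % n)) := by
      intro i hi
      have hi' := Finset.mem_range.1 hi
      rw [show y + (d + 1 + i) = y + d + 1 + i by omega, hru, hpu, Nat.mod_mod, if_neg, if_neg]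
      · rw [show y + d + 1 + i = y + (d + 1 + i) by omega]
        exact fun h => mod_add_ne_mod (i := y) (t := d + 1 + i) (n := n) (by omega) (by omega) (h.trans hymod.symm)
      · rw [show y + d + 1 + i = (y + d) + (1 + i) by omega]; exact mod_add_ne_mod (by omega) (by omega)
    simp only []
    rw [fy, fz, Finset.prod_congr rfl fA, Finset.prod_congr rfl fB]
    ring
  unfold transferT
  rw [← trace_seg_rotate q _ _ n y hy.le, hword, mul_assoc (2 - q) (∏ j ∈ Finset.range n, rOf u v n j), hprod]
  ring

/-- **THEOREM W — any two spokes of an apex-over-cycle weighted graph are negatively correlated for `0 < q ≤ 1`.**  The second spoke is written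
`s(x, v ((y + d) % n))`, `1 ≤ d ≤ n − 1` (every rim vertex other than `v y` has this form). (transcription of bschramm/prim-bschramm-fk-3/WHEELS-HUB-NC.md §0–§5) -/
theorem wheel_negCorr_spokes {q : ℝ} (hq0 : 0 < q) (hq1 : q ≤ 1) (w : Sym2 V → unitInterval)
    (hsupp : ∀ e, e ∉ wheelPairs x v n → w e = 0) {y d : ℕ} (hy : y < n) (hd1 : 1 ≤ d) (hdn : d + 1 ≤ n) :
    (rcMeasureW w q ∅).real ({ω : BondConfig V | spokePair x v n y ∈ ω} ∩ {ω | spokePair x v n (y + d) ∈ ω}) ≤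
      (rcMeasureW w q ∅).real {ω : BondConfig V | spokePair x v n y ∈ ω} *
        (rcMeasureW w q ∅).real {ω : BondConfig V | spokePair x v n (y + d) ∈ ω} := by
  have hzlt : (y + d) % n < n := Nat.mod_lt _ (by omega)
  have hymod : y % n = y := Nat.mod_eq_of_lt hy
  have hyz : (y + d) % n ≠ y := fun h => mod_add_ne_mod (i := y) (t := d) (n := n) (by omega) (by omega) (h.trans hymod.symm)
  have hspz : spokePair x v n (y + d) = spokePair x v n ((y + d) % n) := (spokePair_mod x v n (y + d)).symm
  have hfe : spokePair x v n (y + d) ≠ spokePair x v n y := by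
    rw [hspz]; exact fun h => hyz ((spokePair_eq_iff hinj hzlt hy).1 h)
  have hsupp1 : ∀ (a' b' : unitInterval), ∀ g, g ∉ wheelPairs x v n →
      Function.update (Function.update w (spokePair x v n y) a') (spokePair x v n (y + d)) b' g = 0 := by
    intro a' b'
    have h1 := supp_update_spoke w hsupp hy a'
    rw [hspz]
    exact supp_update_spoke _ h1 hzlt b'
  -- partition functions of the four pinnings
  have hZ : ∀ (a' b' : unitInterval),
      rcPartitionFunctionW (Function.update (Function.update w (spokePair x v n y) a') (spokePair x v n (y + d)) b') q ∅ =
        transferT q (Function.update (Function.update w (spokePair x v n y) a') (spokePair x v n (y + d)) b') x v n :=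
    fun a' b' => rcPartitionFunctionW_eq_transferT hn hinj hx hcard q _ (hsupp1 a' b')
  have hT := fun (a' b' : unitInterval) => transferT_two_slot hn hinj hx q w hy hd1 hdn a' b'
  -- the invariants of the stretches
  have hp01 : ∀ j, 0 ≤ pOf w x v n j ∧ pOf w x v n j ≤ 1 := fun j => ⟨(w _).2.1, (w _).2.2⟩
  have hr01 : ∀ j, 0 ≤ rOf w v n j ∧ rOf w v n j ≤ 1 := fun j => ⟨(w _).2.1, (w _).2.2⟩
  have hIA : RimInv q ((∏ i ∈ Finset.range (d - 1), (rOf w v n ((y + 1 + i) % n) * (1 - pOf w x v n ((y + 1 + i) % n)))) * rOf w v n y)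
      (seg q (pOf w x v n) (rOf w v n) n (y + 1) (d - 1) * edgeM q (rOf w v n y)) := by
    have h0 := (RimInv.one q).edge_mul hq0.le hq1 (hr01 y).1 (hr01 y).2
    rw [Matrix.mul_one, mul_one] at h0
    exact rimInv_seg_mul hq0.le hq1 hp01 hr01 n (y + 1) h0 (d - 1)
  have hIB : RimInv q ((∏ i ∈ Finset.range (n - d - 1), (rOf w v n ((y + d + 1 + i) % n) * (1 - pOf w x v n ((y + d + 1 + i) % n)))) *
        rOf w v n ((y + d) % n))
      (seg q (pOf w x v n) (rOf w v n) n (y + d + 1) (n - d - 1) * edgeM q (rOf w v n ((y + d) % n))) := by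
    have h0 := (RimInv.one q).edge_mul hq0.le hq1 (hr01 ((y + d) % n)).1 (hr01 ((y + d) % n)).2
    rw [Matrix.mul_one, mul_one] at h0
    exact rimInv_seg_mul hq0.le hq1 hp01 hr01 n (y + d + 1) h0 (n - d - 1)
  have hTF := wheelHub_trace_form hq1 hIA hIB
  -- abbreviate the stretch data AFTER all the facts are in place
  generalize hA : seg q (pOf w x v n) (rOf w v n) n (y + 1) (d - 1) * edgeM q (rOf w v n y) = A at hT hTF
  generalize hB : seg q (pOf w x v n) (rOf w v n) n (y + d + 1) (n - d - 1) * edgeM q (rOf w v n ((y + d) % n)) = B at hT hTF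
  generalize hρA : (∏ i ∈ Finset.range (d - 1), (rOf w v n ((y + 1 + i) % n) * (1 - pOf w x v n ((y + 1 + i) % n)))) * rOf w v n y = ρA
    at hT hTF
  generalize hρB : (∏ i ∈ Finset.range (n - d - 1), (rOf w v n ((y + d + 1 + i) % n) * (1 - pOf w x v n ((y + d + 1 + i) % n)))) *
      rOf w v n ((y + d) % n) = ρB at hT hTF
  -- the weights of the two spokes
  have ha0 : 0 ≤ ((w (spokePair x v n y) : unitInterval) : ℝ) := (w _).2.1
  have ha1 : ((w (spokePair x v n y) : unitInterval) : ℝ) ≤ 1 := (w _).2.2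
  have hb0 : 0 ≤ ((w (spokePair x v n (y + d)) : unitInterval) : ℝ) := (w _).2.1
  have hb1 : ((w (spokePair x v n (y + d)) : unitInterval) : ℝ) ≤ 1 := (w _).2.2
  -- masses
  have hZw : rcPartitionFunctionW w q ∅ =
      rcPartitionFunctionW (Function.update (Function.update w (spokePair x v n y) (w (spokePair x v n y))) (spokePair x v n (y + d))
        (w (spokePair x v n (y + d)))) q ∅ := by
    rw [Function.update_eq_self, Function.update_eq_self]
  have hSe : ∑ ω : BondConfig V, rcWeightW w q ∅ ω * ind {ω : BondConfig V | spokePair x v n y ∈ ω} ω =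
      ((w (spokePair x v n y) : unitInterval) : ℝ) *
        rcPartitionFunctionW (Function.update (Function.update w (spokePair x v n y) 1) (spokePair x v n (y + d)) (w (spokePair x v n (y + d)))) q ∅ := by
    rw [sum_openPair_eq_mul_Z w q (spokePair x v n y)]
    congr 2
    conv_lhs => rw [← Function.update_eq_self (spokePair x v n (y + d)) (Function.update w (spokePair x v n y) 1)]
    rw [Function.update_of_ne hfe]
  have hSf : ∑ ω : BondConfig V, rcWeightW w q ∅ ω * ind {ω : BondConfig V | spokePair x v n (y + d) ∈ ω} ω =
      ((w (spokePair x v n (y + d)) : unitInterval) : ℝ) *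
        rcPartitionFunctionW (Function.update (Function.update w (spokePair x v n y) (w (spokePair x v n y))) (spokePair x v n (y + d)) 1) q ∅ := by
    rw [sum_openPair_eq_mul_Z w q (spokePair x v n (y + d)), Function.update_eq_self]
  have hSef : ∑ ω : BondConfig V, rcWeightW w q ∅ ω * ind ({ω : BondConfig V | spokePair x v n y ∈ ω} ∩ {ω | spokePair x v n (y + d) ∈ ω}) ω =
      ((w (spokePair x v n y) : unitInterval) : ℝ) * ((w (spokePair x v n (y + d)) : unitInterval) : ℝ) *
        rcPartitionFunctionW (Function.update (Function.update w (spokePair x v n y) 1) (spokePair x v n (y + d)) 1) q ∅ :=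
    sum_openPair_inter_openPair_eq w q hfe
  -- the trace expansion in the entries of `A`, `B`
  have tII : ∀ c c' : ℝ, (B * spokeM c' * A * spokeM c).trace =
      (1 - c) * (1 - c') * (A * B).trace + c * (1 - c') * ((B * A) 0 0 + (B * A) 1 0) + (1 - c) * c' * ((A * B) 0 0 + (A * B) 1 0) +
        c * c' * ((A 0 0 + A 1 0) * (B 0 0 + B 1 0)) := by
    intro c c'; simp [spokeM, Matrix.trace_fin_two, Matrix.mul_apply, Fin.sum_univ_two]; ring
  -- the main inequality between masses: `S(J_e ∩ J_f)·Z ≤ S(J_e)·S(J_f)`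
  have hnn : 0 ≤ q ^ 2 * (((w (spokePair x v n y) : unitInterval) : ℝ) * ((w (spokePair x v n (y + d)) : unitInterval) : ℝ)) *
      ((1 - ((w (spokePair x v n y) : unitInterval) : ℝ)) * (1 - ((w (spokePair x v n (y + d)) : unitInterval) : ℝ))) *
      (((B * A) 0 0 + (B * A) 1 0) * ((A * B) 0 0 + (A * B) 1 0) -
        ((A 0 0 + A 1 0) * (B 0 0 + B 1 0)) * ((A * B).trace - (2 - q) * ρA * ρB)) := by
    apply mul_nonneg
    · exact mul_nonneg (mul_nonneg (sq_nonneg q) (mul_nonneg ha0 hb0)) (mul_nonneg (sub_nonneg.2 ha1) (sub_nonneg.2 hb1))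
    · linarith [hTF]
  have key : ∀ (a b tAB tBA tABc pp ρ : ℝ),
      (a * (q * ((1 - 1) * (1 - b) * tAB + 1 * (1 - b) * tBA + (1 - 1) * b * tABc + 1 * b * pp - (2 - q) * ρ * ((1 - 1) * (1 - b))))) *
          (b * (q * ((1 - a) * (1 - 1) * tAB + a * (1 - 1) * tBA + (1 - a) * 1 * tABc + a * 1 * pp - (2 - q) * ρ * ((1 - a) * (1 - 1))))) -
        (a * b * (q * ((1 - 1) * (1 - 1) * tAB + 1 * (1 - 1) * tBA + (1 - 1) * 1 * tABc + 1 * 1 * pp - (2 - q) * ρ * ((1 - 1) * (1 - 1))))) *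
          (q * ((1 - a) * (1 - b) * tAB + a * (1 - b) * tBA + (1 - a) * b * tABc + a * b * pp - (2 - q) * ρ * ((1 - a) * (1 - b)))) =
      q ^ 2 * (a * b) * ((1 - a) * (1 - b)) * (tBA * tABc - pp * (tAB - (2 - q) * ρ)) := by
    intro a b tAB tBA tABc pp ρ; ring
  have main : (∑ ω : BondConfig V, rcWeightW w q ∅ ω * ind ({ω : BondConfig V | spokePair x v n y ∈ ω} ∩ {ω | spokePair x v n (y + d) ∈ ω}) ω) *
      rcPartitionFunctionW w q ∅ ≤
      (∑ ω : BondConfig V, rcWeightW w q ∅ ω * ind {ω : BondConfig V | spokePair x v n y ∈ ω} ω) *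
        ∑ ω : BondConfig V, rcWeightW w q ∅ ω * ind {ω : BondConfig V | spokePair x v n (y + d) ∈ ω} ω := by
    rw [hSef, hSe, hSf, hZw, hZ, hZ, hZ, hZ, hT, hT, hT, hT, Set.Icc.coe_one, tII, tII, tII, tII]
    have k := key ((w (spokePair x v n y) : unitInterval) : ℝ) ((w (spokePair x v n (y + d)) : unitInterval) : ℝ) (A * B).trace
      ((B * A) 0 0 + (B * A) 1 0) ((A * B) 0 0 + (A * B) 1 0) ((A 0 0 + A 1 0) * (B 0 0 + B 1 0)) (ρA * ρB)
    nlinarith [k, hnn]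
  -- to probabilities
  have hZpos := rcPartitionFunctionW_pos w hq0 (∅ : Set V)
  rw [rcMeasureW_real_eq_sum_div w hq0, rcMeasureW_real_eq_sum_div w hq0, rcMeasureW_real_eq_sum_div w hq0, div_mul_div_comm,
    div_le_div_iff₀ hZpos (mul_pos hZpos hZpos)]
  nlinarith [mul_le_mul_of_nonneg_right main hZpos.le]

end Main

end Wheel

end FK

end Summit.CriticalPhenomena.PercolationContinuityZ3.Theorems

end
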